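import Literature.Analysis.FluidPDE.KNSSLiouvillePlanarHolds
import HarnessLib

/-!
# KNSS 2009, §4 on a finite window: the drift-mild smoothing half, discharged

Analysis/FluidPDE proofs file (everything proved; no named facts) closing the named fact
`Literature.Analysis.FluidPDE.KNSS2009_driftMild_regularity` (`KNSSRegularityDecomposition.lean`;
Koch–Nadirashvili–Seregin–Šverák, Acta Math. 203 (2009) = arXiv:0709.3599v1, §4, closing
paragraph: the bounds (4.10)–(4.11) and the vorticity equation (4.8) for the decomposed solution
`u = v + w + b` of Lemma 3.1, in the drift-mild rendering `IsKNSSDriftMild T N U b`).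

Both ingredients are already theorems of the tree:

* `KNSS2009_mild_regularity_holds` (`KNSSLiouvillePlanarHolds.lean`) — the zero-drift case
  `b ≡ 0` (KNSS's Proposition 4.1 with (4.6) and (4.8)–(4.11) for bounded mild solutions on `ℝ³`,
  assembled from the a priori bootstrap `KNSSBootstrap.level_all`);
* `KNSS2009_driftMild_regularity_of_mild'` (`KNSSRegularityGalileanProofs.lean`) — the reduction of
  the drift-mild statement to its zero-drift case by the Galilean covariance of the drift-mild
  class on `ℝ³` (`IsKNSSDriftMild.galileanCovariance_R3`), packaged as the equivalence
  `KNSS2009_driftMild_regularity_iff_mild_regularity` (`KNSSRegularityWindowOfProp41.lean`).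

The discharge cannot live in `KNSSRegularityDecomposition.lean` itself (the proofs above import
it), hence this sibling file. With it, both halves of the decomposition
(`KNSS2009_weak_driftMild_holds`, `KNSSWeakDriftMildProofs.lean`, and the present theorem) and the
glued window fact (`KNSS2009_regularity_boundedWeak_window_holds`, `KNSSThm53OfWindow.lean`) are
theorems (the glue `KNSS2009_regularity_boundedWeak_window_of_driftMild` of the decomposition file
fed with the two discharged halves yields the window fact once more; the tree's
`KNSS2009_regularity_boundedWeak_window_holds` reaches it through
`KNSS2009_regularity_boundedWeak_window_of_mild_regularity`, so no second copy is recorded here).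

## References

* G. Koch, N. Nadirashvili, G. Seregin, V. Šverák, *Liouville theorems for the Navier–Stokes
  equations and applications*, Acta Math. 203 (2009) 83–105 = arXiv:0709.3599v1: §3 Lemma 3.1
  (p. 7); §4 Proposition 4.1, (4.6), and the closing paragraph (4.8)–(4.11) (p. 8).
  [KochNadirashviliSereginSverak2009]
-/

noncomputable section

namespace Literature.Analysis.FluidPDE

/-- **KNSS 2009, §4, regularity of the decomposed solution (`KNSS2009_driftMild_regularity`),
PROVED**: the zero-drift case (`KNSS2009_mild_regularity_holds`) transported along the Galilean
shift `y ↦ y + ∫₀ᵗ b` (`KNSS2009_driftMild_regularity_of_mild'`). [cite: KochNadirashviliSereginSverak2009, §4 (4.8)–(4.11) with Prop. 4.1 and Lemma 3.1 (arXiv:0709.3599v1 pp. 7–8)] -/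
theorem KNSS2009_driftMild_regularity_holds : KNSS2009_driftMild_regularity :=
  KNSS2009_driftMild_regularity_of_mild' KNSS2009_mild_regularity_holds

end Literature.Analysis.FluidPDE

end
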